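import Literature.Computability.Cryptography.SamplingProblems
import Literature.Computability.Cryptography.QuantumCircuitProofs
import Literature.Computability.Cryptography.QubitRegisterPauliZProofs
import Literature.Computability.Cryptography.QubitRegisterCzProofs
import Literature.Computability.Cryptography.QubitRegisterTGateProofs
import HarnessLib

/-!
# IQP circuits are unitary — discharge of `iqpUnitary_mem_unitaryGroup`

Proof of the named fact `Literature.Computability.Cryptography.iqpUnitary_mem_unitaryGroup`
stated in `Literature.Computability.Cryptography.SamplingProblems`, kept in its own sibling file
(like `SamplingProblemsIqpDiagProofs.lean`): the shared `SamplingProblemsProofs.lean` only needs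
`SamplingProblems`, whereas the present discharge additionally needs the single-gate discharges
`pauliZ_mem_unitaryGroup_holds`, `cz_mem_unitaryGroup_holds`, `tGate_mem_unitaryGroup_holds`
(`QubitRegister{PauliZ,Cz,TGate}Proofs`) and the circuit-level discharge
`QCircuit.toMatrix_mem_unitaryGroup_holds` (`QuantumCircuitProofs`), and one file per discharge
cannot be lost to a concurrent whole-file resubmission of the shared proofs file.

* `QCircuit.mat_mem_unitaryGroup_of_iqpDiag`: the matrix `U_D` of a circuit `D` over `iqpDiag`
  is unitary (`QCircuit.toMatrix_mem_unitaryGroup_holds` at the empty oracle; its hypothesis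
  "`iqpDiag` is a unitary gate set" is the case split `Z`/`CZ`/`T` into the three single-gate
  discharges — the same argument as the standalone discharge `iqpDiag_isUnitary_holds` of
  `SamplingProblemsIqpDiagProofs.lean`, inlined here so that this file does not depend on it).
* `iqpUnitary_mem_unitaryGroup_holds` discharges `iqpUnitary_mem_unitaryGroup`: the IQP unitary
  `iqpUnitary D = H^{⊗N} · U_D · H^{⊗N}` is a product of three unitaries
  (`hGateAll_mem_unitaryGroup_holds` twice and the previous item), and
  `Matrix.unitaryGroup (QReg N) ℂ` is a submonoid of the matrix ring.

Mathematical source. Bremner–Jozsa–Shepherd define an IQP circuit on `n` qubit lines as "a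
quantum circuit with the following structure: each gate in the circuit is diagonal in the `X`
basis `{|0⟩ ± |1⟩}`, the input state is `|0⟩|0⟩…|0⟩` and the output is the result of a
computational basis measurement on a specified set of output lines" (§2.3, Definition 2), and
record the equivalent `Z`-basis representation realised by `iqpUnitary`: "each qubit line begins
and ends with a Hadamard (`H`) gate, and in between, every gate is diagonal in the `Z` basis. This
is easily seen to be equivalent to the previous definition (by inserting two `H`'s on each line
between each pair of gates, recalling that `HH = I` …)" (§2.3, paragraph after Definition 2;
arXiv:1005.1407 p. 4). Being a quantum circuit in the sense of §2.2 ("the circuits `C_w` comprise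
quantum gates, each acting on a constant number of lines"), its overall operator is unitary as a
product of unitary gates (Nielsen–Chuang 2010, §4.2–§4.3: single-qubit and controlled gates are
unitary matrices; a circuit applies them in sequence). The named fact records exactly this for
the concrete diagonal gate set `{Z, CZ, T}` of `iqpDiag`.

## References

* M. J. Bremner, R. Jozsa, D. J. Shepherd, *Classical simulation of commuting quantum
  computations implies collapse of the polynomial hierarchy*, Proc. R. Soc. A 467 (2011)
  459–472, doi:10.1098/rspa.2010.0301, arXiv:1005.1407: §2.2 (uniform circuit families; quantum
  circuits comprise quantum gates), §2.3 Definition 2 and the following paragraph (IQP circuits;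
  `Z`-basis form `H … H` with `Z`-diagonal gates in between, `HH = I`).
  [cite: BremnerJozsaShepherd2011, §2.3 Def. 2 and following paragraph]
* M. A. Nielsen, I. L. Chuang, *Quantum Computation and Quantum Information*, 10th anniversary
  ed., Cambridge University Press 2010, §4.2–§4.3 (quantum gates are unitary matrices; circuits
  compose them).
-/

namespace Literature.Computability.Cryptography

open Matrix

/-- The operator `U_D` of a circuit `D` over the diagonal IQP gate set `{Z, CZ, T}` is unitary: a
circuit over a unitary gate set computes a unitary matrix for every oracle
(`QCircuit.toMatrix_mem_unitaryGroup_holds`; here at the empty oracle, i.e. `QCircuit.mat`), and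
`iqpDiag` is a unitary gate set since each of `Z = diag(1,-1)`, `CZ = diag(1,1,1,-1)` and
`T = diag(1, e^{iπ/4})` is a unitary matrix (`pauliZ_mem_unitaryGroup_holds`,
`cz_mem_unitaryGroup_holds`, `tGate_mem_unitaryGroup_holds`; Nielsen–Chuang 2010, Ex. 2.19,
Ex. 4.17, §4.2 eq. (4.2)). (Bremner–Jozsa–Shepherd 2011, §2.2 "the circuits `C_w` comprise
quantum gates" and §2.3 Def. 2; Nielsen–Chuang 2010, §4.2.)
[cite: BremnerJozsaShepherd2011, §2.3 Def. 2] -/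
theorem QCircuit.mat_mem_unitaryGroup_of_iqpDiag {N : ℕ} (D : QCircuit iqpDiag N) :
    D.mat ∈ Matrix.unitaryGroup (QReg N) ℂ := by
  refine QCircuit.toMatrix_mem_unitaryGroup_holds (G := iqpDiag) (n := N) ?_ 0 D
  rintro (_ | _ | _)
  · exact pauliZ_mem_unitaryGroup_holds
  · exact cz_mem_unitaryGroup_holds
  · exact tGate_mem_unitaryGroup_holds

/-- **Discharge of `iqpUnitary_mem_unitaryGroup`.** IQP unitaries are unitary: for a circuit `D`
over `iqpDiag` on `N` wires, `iqpUnitary D = H^{⊗N} · U_D · H^{⊗N}` is the product of the unitary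
`H^{⊗N}` (`hGateAll_mem_unitaryGroup_holds`), the unitary `U_D`
(`QCircuit.mat_mem_unitaryGroup_of_iqpDiag`) and `H^{⊗N}` again, and the unitary group
`Matrix.unitaryGroup (QReg N) ℂ` is closed under products (`mul_mem`). This is the `Z`-basis form
of an IQP circuit of Bremner–Jozsa–Shepherd — "each qubit line begins and ends with a Hadamard
(`H`) gate, and in between, every gate is diagonal in the `Z` basis" (§2.3, paragraph after
Definition 2) — which is a quantum circuit (§2.2) and hence a unitary operator.
[cite: BremnerJozsaShepherd2011, §2.3 Def. 2 and following paragraph] -/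
theorem iqpUnitary_mem_unitaryGroup_holds : iqpUnitary_mem_unitaryGroup := by
  intro N D
  unfold iqpUnitary
  exact mul_mem (mul_mem (hGateAll_mem_unitaryGroup_holds N)
    (QCircuit.mat_mem_unitaryGroup_of_iqpDiag D)) (hGateAll_mem_unitaryGroup_holds N)

end Literature.Computability.Cryptography
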